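import Summits.QuantumFields.BalabanUV.T4Continuum.Support.SubstrateChartRelatedPair
import Summits.QuantumFields.BalabanUV.T4Continuum.Support.SubstrateComplexBackgroundLev

/-!
# SUBSTRATE — [dict]∕[H∃] W-22′ = L-E16′: THE FINE-FIELD CHART OF ROAD D (NE5 owner ruling R58, `HOME/CLAIMS.log` l.22206; substrate typer (ο7),
# l.22257): complex one-parameter FINE-FIELD SLICES through the reading points of the recursion chart, centred at run B's averaging towers of
# record, carrying the two analytic letters (L2′) = COMPLEX BLOCK-AVERAGING HOLOMORPHY + DEPTH CONTROL and the REAL TIE as DISPLAYED fields;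
# END = the `hdrv` binder of `OutputRateDrivingSlices.hslice_of_drivingSlices` (p238560, tree l.167–168) TOKEN FOR TOKEN at the R58 (1′)
# substitutions `Coord := TowerData (P (K+1)) o`, `𝒱 := TwoRunChart D o`, `Ctr = BgR := ↥Wreg ⊆ D.carriers.BgB` (resp. the whole carrier),
# `χ b := relPair D ∘ expChartT _ (towerDataOf _ ι D.avB b)`, `ρ := sectionOfRecord D ι (∘ Subtype.val)`

Cell `pub-balaban`, SUBSTRATE cell, seat `b2b-balaban-substrate-p2` (gen 6).  Summits-side under the LEAN PLACEMENT RULE ([folklore] chart bookkeeping;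
nothing printed is asserted; no citation tags; no `Prop`-valued fact minted).  Follower of W-20 `SubstrateChartRelatedPair` (p232891: `resA`, `relPair`,
`pairPoint_relPair`, `sectionOfRecord_eq_relPair`, `norm_resA_le`) and of the complex-family layer `SubstrateComplexBackground(Lev)` (p222080 ∕ p223543:
`ComplexBackgroundFamily.ofChart`, `differentiableOn_covAtTLev_family`, `mem_regularLev_ofChart_of_norm_lt_rhoStar`) BY NAME; nothing restated.  NO import
of the NE5 owner's `OutputRateDrivingSlices` (typer (ο7-1)(α′)): the junction feeding `hdrv_on` ∕ `hdrv` below into `hslice_of_drivingSlices` is an `example`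
in the author's prototype scratch and in the X-reader's probe (junction J-avg), not a tree import.

HONEST FRAMING: rung (B)+1 of the FINITE-VOLUME T⁴ programme — NOT infinite volume, NOT a mass gap, NOT Clay; spine PROVED 0∕9; NE5 NOT PRINTED ∕ NOT
PROVED; substrate = data + structural lemmas + bookkeeping, NO estimate of any NE row.  THIS MODULE IS AN INTERFACE ([dict] identification + [H∃]
letters): the slice coordinate `a = 𝒞.slice k u : ℂ → TowerData _ o` is «the tower-chart coordinate, relative to run B's averaging tower of record at a
real admissible fine field `b`, of the COMPLEX covariant-averaging tower of the fine-field slice `z ↦ b·exp(z·H)`» ONLY BY INTENT — its two analytic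
letters (2′) `DiffContOnCl ℂ a (ball 0 1)` (complex block-averaging holomorphy: Bałaban's covariant averaging (0.4) extended to complex configurations
near unitary ones — products of bond variables along contours and the `(XX*)^{−1∕2}` normalisation analytic near `1`; [Balaban1985Averaging],
[Balaban1987RG1] (0.4)–(0.7) KIND) and (3) `MapsTo a (closedBall 0 1) (ball 0 (ϱ k b))` (depth control), and the REAL TIE (4) «real parameters give
AVERAGING TOWERS OF REAL ADMISSIBLE FIELDS», are DISPLAYED STRUCTURE FIELDS, INHABITED BY NOBODY on Bałaban's objects (the construction `towerDataOfℂ`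
is the separate, unassigned item L-E18 = W-24, typer (ο7-4)); `FineFieldChart.trivial` inhabits the TYPE only (constant slices at reading points that
are themselves real feet) and says nothing about averaging.  NO driven data anywhere (R58 (3′)∕(β′): no `D.uB`, no `domV`, no minimiser letter — the
driving chart of typer sketch v0.11 ∕ R57 is the demoted alternative, not filed).  HONEST DEPENDENCY (cell line, verbatim): continuum YM on T⁴ ⇐
BetaPertH ∧ nine spine estimates (0/9 proved); BetaPertH ⇐ (D1) ∧ (D4) ∧ CAP+tail; G-an2-4 gates asym, D1 and NE2/3/4.

WHY (R58 (1′)(4′), typer (ο7-1)).  On Road D of record the W1 binder is consumed at COMPLEX reading points `u : 𝒰` of the recursion chart, read into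
the two-run chart `𝒱 := TwoRunChart D o` by `emb`, and is produced there by `OutputRateDrivingSlices.weightedEntrywiseRate_complex_of_drivingSlices`
(§3∕§4 of p238560, ROAD-AGNOSTIC) from: `hwer` on a REAL datum type `BgR` read through `ρ : BgR → 𝒱`; the species-in-chart letters (L1) on coordinate
balls `ball 0 (ϱ k b)` around real centres `b : Ctr` (substrate: LANDED for cov ∕ Green on explicit balls); and the slice letter `hdrv` — through every
`(k, u)` a centre `b`, a coordinate slice `a : ℂ → Coord` and a parameter `‖z₀‖ ≤ r` with `χ b (a z₀) = emb u`, REAL FEET `χ b (a x) ∈ Set.range ρ`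
(`|x| < 1`), `DiffContOnCl ℂ a (ball 0 1)`, `MapsTo a (closedBall 0 1) (ball 0 (ϱ k b))`.  R58 fixes the instance: the real window is the AVERAGING-TOWER
window — `BgR = Ctr :=` (a window `Wreg` of) run B's admissible real fine fields `D.carriers.BgB`, `ρ := sectionOfRecord D ι` (run A through the
block-averaging transport = `resA` of run B's tower, W-20 `sectionOfRecord_eq_relPair`), `Coord := TowerData (D.F.P (D.K+1)) o` (run-B tower coordinates;
run A's factor is READ through `resA`, so ONE coordinate serves the pair: `χ b := relPair D ∘ expChartT _ (towerB b)`), and the slices are FINE-FIELD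
slices, whose real feet are averaging towers of real fields BY CONSTRUCTION — here: by the displayed tie (4).  This module types exactly that and
proves the END in the consumer's binder shape; `𝒰`, `emb`, `r`, `ϱ`, `Wreg` are PARAMETERS (the reading points and radii are the row's).

WHAT.
* §1 `towerB D ι b` (run B's averaging tower of record at `b : D.carriers.BgB`; `towerB_eq_sectionOfRecord_snd` rfl), `rho_apply`, `chartAt D ι b c := relPair D (expChartT _ (towerB D ι b) c)` (= `χ b c`),
  `rho D ι Wreg` (= `sectionOfRecord D ι ∘ Subtype.val` on a window); `chartAt_zero` (`χ b 0 = sectionOfRecord D ι b`: W-20 + `expChartT_zero` BY NAME),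
  `chartAt_eq_pairPoint` (the pair-chart reading, W-20 `pairPoint_relPair`), `chartAt_fst ∕ _snd`, `chartAt_eq_sectionOfRecord_of_tie`,
  `chartAt_mem_range_rho_of_tie`, `range_rho_univ`.
* §1b `resAL` (`resA` as a CLM, norm ≤ 1; `resAL_apply` rfl), `differentiable_resA`, `continuous_resA`, `mapsTo_resA_ball`, `resA_towerB`, **`hKA_of_resA`** ∕ `hKB_of_chart` (the two
  runs' (L1) clauses of `hslice_of_drivingSlices` at `χ := chartAt D ι` from each run's OWN explicit-ball chart letter — run A by the chain rule through `resA`).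
* §2 **`FineFieldChart D ι Wreg 𝒰 emb ϱ r`** — per level `k` and reading point `u`: centre `ctr k u ∈ Wreg`, slice `slice k u : ℂ → TowerData _ o` with
  (1) `slice_zero`, (2′) `diffContOnCl`, (3) `mapsTo`, (4) `real` (tie, landing in `Wreg`), (5) `param`, `norm_param_le`, `reach`; `FineFieldChart.relax`
  (larger radii ∕ larger window ∕ larger depth); **`FineFieldChart.hdrv_on`** = THE END on a window (`Ctr = BgR := ↥Wreg`, `ρ := rho D ι Wreg`) and
  **`FineFieldChart.hdrv`** = THE END on the whole carrier (`Wreg := univ`; `Ctr = BgR := D.carriers.BgB`, `ρ := sectionOfRecord D ι`) — both literally the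
  `hdrv` binder of `hslice_of_drivingSlices`; `FineFieldChart.trivial` (TYPE non-vacuity only) with `trivial_slice`.
* §3 (typer (ε′)) the slice as a chart-coordinate COMPLEX BACKGROUND FAMILY of record: `differentiableOn_slice_apply` (per-entry holomorphy from (2′)),
  `FineFieldChart.family k u := ComplexBackgroundFamily.ofChart (towerB (ctr k u)) 1 (slice k u) …`, `family_uC` ∕ `family_uC_eq_chartAt_snd` (rfl), **`differentiableOn_covB_slice`** ∕
  **`differentiableOn_covA_slice`** (run B's ∕ run A's level-lettered covariance species along the slice are ℂ-differentiable on the regular part of the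
  disc — p223543 `differentiableOn_covAtTLev_family` + W-20 `covAtTLev_resA` BY NAME), **`mem_regularLev_slice_of_le`** (depth control (3) with
  `ϱ k b ≤ ρ⋆` buys regularity at every level on the CLOSED unit disc — p223543 `mem_regularLev_ofChart_of_norm_lt_rhoStar` BY NAME): (L1) and (L2′) meet
  on the same chart.
0 sorry; axioms ⊆ {propext, Classical.choice, Quot.sound}.
-/

noncomputable section

open scoped BigOperators ComplexConjugate Matrix Matrix.Norms.L2Operator Kronecker ComplexOrder
open Set Metric

namespace Summit.QuantumFields.BalabanUV.T4Continuum.SubstrateFineFieldChart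

open Literature.MathematicalPhysics.QuantumFieldTheory.Balaban1983to89
open Literature.MathematicalPhysics.QuantumFieldTheory.Balaban1983to89.B5Prop11Plancherel (Tor fine)
open Literature.MathematicalPhysics.QuantumFieldTheory.Balaban1983to89.B5G183RateUnitTower (lev lev_neZero)
open Summit.QuantumFields.BalabanUV.T4Continuum
open Summit.QuantumFields.BalabanUV.T4Continuum.CoerciveInverseTower (Coercive)
open Summit.QuantumFields.BalabanUV.T4Continuum.CovariantVectorCoercive (vecOp)
open Summit.QuantumFields.BalabanUV.T4Continuum.CovariantBlockAveraging (ContourSystem)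
open Summit.QuantumFields.BalabanUV.T4Continuum.SubstrateBackgroundTransporters (unitMod)
open Summit.QuantumFields.BalabanUV.T4Continuum.SubstrateTransporterSpecies
open Summit.QuantumFields.BalabanUV.T4Continuum.SubstrateTransporterSpeciesHolo (expChartT expChartInvT expChartT_zero)
open Summit.QuantumFields.BalabanUV.T4Continuum.SubstrateTransporterSpeciesLev (covAtTLev rhoStar cPr aPr)
open Summit.QuantumFields.BalabanUV.T4Continuum.SubstrateComplexBackground (ComplexBackgroundFamily)
open Summit.QuantumFields.BalabanUV.T4Continuum.SubstrateComplexBackgroundLev (regularLev differentiableOn_covAtTLev_family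
  mem_regularLev_ofChart_of_norm_lt_rhoStar)
open Summit.QuantumFields.BalabanUV.T4Continuum.SubstrateChartSection (sectionOfRecord sectionOfRecord_fst sectionOfRecord_snd TwoRunChart)
open Summit.QuantumFields.BalabanUV.T4Continuum.SubstrateChartRealSlicePair (pairPoint)
open Summit.QuantumFields.BalabanUV.T4Continuum.SubstrateChartRelatedPair (resA relPair relPair_fst relPair_snd resA_add resA_smul norm_resA_le
  resA_expChartT pairPoint_relPair sectionOfRecord_eq_relPair covAtTLev_resA)
open Summit.QuantumFields.BalabanUV.T4Continuum.SubstrateTwoRunsDriven (DrivenRuns)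

variable {G : Type} [GaugeGroup G] (D : DrivenRuns G) {o : Type} [Fintype o] [DecidableEq o] (ι : G →* Matrix o o ℂ)

/-! ## §1 The chart of record at a real admissible fine field of run B -/

/-- [folklore] **RUN B's AVERAGING TOWER OF RECORD** at the real admissible fine field `b` (`towerDataOf` of p220490: level `k` reads the transporters,
after `ι`, of the `(K+1−k)`-fold block average of `b`) — the CENTRE of every fine-field slice and the run-B factor of `sectionOfRecord D ι b`. -/
def towerB (b : D.carriers.BgB) : TowerData (D.F.P (D.K + 1)) o := towerDataOf (D.F.P (D.K + 1)) ι D.avB b.1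

/-- [folklore] `towerB` is the run-B factor of the section of record (`rfl`). -/
theorem towerB_eq_sectionOfRecord_snd (b : D.carriers.BgB) : towerB D ι b = (sectionOfRecord D ι b).2 := rfl

/-- [folklore] **THE CHART OF RECORD AT `b`** (R58 (1′) `χ b := relPair D ∘ expChartT _ (towerB b)`): a run-B tower coordinate `c` is read as the RELATED
PAIR of the tower `expChartT _ (towerB b) c` — run A's factor through `resA` (= the tower of the block-averaging transport, W-20 `towerDataOf_transport`),
run B's factor the tower itself.  ONE coordinate serves both runs. -/
def chartAt (b : D.carriers.BgB) (c : TowerData (D.F.P (D.K + 1)) o) : TwoRunChart D o := relPair D (expChartT _ (towerB D ι b) c)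

/-- [folklore] **THE REAL READING OF RECORD ON A WINDOW** `Wreg ⊆ D.carriers.BgB` (R58 (1′) `ρ := sectionOfRecord D ι ∘ Subtype.val`; the window —
e.g. the (α′, β′)-regular real fine fields — is a PARAMETER: the substrate defines no regularity window anew). -/
def rho (Wreg : Set D.carriers.BgB) : Wreg → TwoRunChart D o := fun b => sectionOfRecord D ι b.1

/-- [folklore] `rho` unfolds (`rfl`). -/
@[simp] theorem rho_apply (Wreg : Set D.carriers.BgB) (b : Wreg) : rho D ι Wreg b = sectionOfRecord D ι b.1 := rfl

/-- [folklore] On the whole carrier the window reading has the same range as `sectionOfRecord D ι` itself. -/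
theorem range_rho_univ : Set.range (rho D ι (Set.univ : Set D.carriers.BgB)) = Set.range (sectionOfRecord D ι (o := o)) :=
  Set.ext fun _ => ⟨fun ⟨b, hb⟩ => ⟨b.1, hb⟩, fun ⟨b, hb⟩ => ⟨⟨b, Set.mem_univ _⟩, hb⟩⟩

/-- [folklore] `chartAt` unfolds (`rfl`). -/
theorem chartAt_apply (b : D.carriers.BgB) (c : TowerData (D.F.P (D.K + 1)) o) : chartAt D ι b c = relPair D (expChartT _ (towerB D ι b) c) := rfl

/-- [folklore] Run B's factor of the chart point is the tower `expChartT _ (towerB b) c` (`rfl`). -/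
theorem chartAt_snd (b : D.carriers.BgB) (c : TowerData (D.F.P (D.K + 1)) o) : (chartAt D ι b c).2 = expChartT _ (towerB D ι b) c := rfl

/-- [folklore] Run A's factor of the chart point is `resA` of run B's, itself the chart point of the restricted data (W-20 `resA_expChartT`, `rfl`). -/
theorem chartAt_fst (b : D.carriers.BgB) (c : TowerData (D.F.P (D.K + 1)) o) :
    (chartAt D ι b c).1 = expChartT _ (resA D (towerB D ι b)) (resA D c) := rfl

/-- [folklore] **THE CHART OF RECORD IS THE PAIR CHART AT THE RELATED CENTRE AND RELATED COORDINATE** (W-20 `pairPoint_relPair`, `rfl`) — so the pair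
packages L-E12∕L-E12b∕L-E12c and W-20∕W-20b apply BY NAME at `(relPair D (towerB b), relPair D c)`. -/
theorem chartAt_eq_pairPoint (b : D.carriers.BgB) (c : TowerData (D.F.P (D.K + 1)) o) :
    chartAt D ι b c = pairPoint D (relPair D (towerB D ι b)) (relPair D c) := rfl

/-- [folklore] **AT THE ORIGIN THE CHART READS THE SECTION OF RECORD** (`χ b 0 = ρ b`): W-20 `sectionOfRecord_eq_relPair` + `expChartT_zero` BY NAME. -/
theorem chartAt_zero (b : D.carriers.BgB) : chartAt D ι b 0 = sectionOfRecord D ι b := by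
  rw [chartAt_apply, expChartT_zero, sectionOfRecord_eq_relPair]; rfl

/-- [folklore] **THE TIE TRANSPORTS TO THE PAIR**: if the coordinate `c` at centre `b` charts the averaging tower of a real admissible field `U`, the chart
point IS the section of record at `U` (W-20 `sectionOfRecord_eq_relPair`). -/
theorem chartAt_eq_sectionOfRecord_of_tie {b U : D.carriers.BgB} {c : TowerData (D.F.P (D.K + 1)) o} (h : expChartT _ (towerB D ι b) c = towerB D ι U) :
    chartAt D ι b c = sectionOfRecord D ι U := by
  rw [chartAt_apply, h, sectionOfRecord_eq_relPair]; rfl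

/-- [folklore] … hence lies in the range of the window reading whenever `U ∈ Wreg` (the third `hdrv` clause, one tie at a time). -/
theorem chartAt_mem_range_rho_of_tie {Wreg : Set D.carriers.BgB} {b U : D.carriers.BgB} (hU : U ∈ Wreg) {c : TowerData (D.F.P (D.K + 1)) o}
    (h : expChartT _ (towerB D ι b) c = towerB D ι U) : chartAt D ι b c ∈ Set.range (rho D ι Wreg) :=
  ⟨⟨U, hU⟩, (chartAt_eq_sectionOfRecord_of_tie D ι h).symm⟩

/-! ## §1b Run A through `resA`: the calculus an instance needs for run A's species-in-chart letter (L1) in the FULL run-B coordinate -/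

/-- [folklore] **`resA` AS A CONTINUOUS LINEAR MAP** (W-20's `resA_add` ∕ `resA_smul` ∕ `norm_resA_le` packaged; operator norm `≤ 1`). -/
def resAL : TowerData (D.F.P (D.K + 1)) o →L[ℂ] TowerData (D.F.P D.K) o :=
  LinearMap.mkContinuous ⟨⟨resA D, resA_add D⟩, resA_smul D⟩ 1 fun A => by rw [one_mul]; exact norm_resA_le D A

/-- [folklore] `resAL` is `resA` (`rfl`). -/
@[simp] theorem resAL_apply (A : TowerData (D.F.P (D.K + 1)) o) : resAL D A = resA D A := rfl

/-- [folklore] `resA` is (entire) ℂ-differentiable. -/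
theorem differentiable_resA : Differentiable ℂ (resA D : TowerData (D.F.P (D.K + 1)) o → TowerData (D.F.P D.K) o) :=
  (resAL D).differentiable

/-- [folklore] `resA` is continuous. -/
theorem continuous_resA : Continuous (resA D : TowerData (D.F.P (D.K + 1)) o → TowerData (D.F.P D.K) o) := (resAL D).continuous

/-- [folklore] `resA` maps every coordinate ball at `0` into the ball of the same radius (W-20 `norm_resA_le`). -/
theorem mapsTo_resA_ball (ϱ : ℝ) : MapsTo (resA D : TowerData (D.F.P (D.K + 1)) o → TowerData (D.F.P D.K) o) (ball 0 ϱ) (ball 0 ϱ) :=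
  fun c hc => mem_ball_zero_iff.2 ((norm_resA_le D c).trans_lt (mem_ball_zero_iff.1 hc))

/-- [folklore] Run A's centre in its own chart: `resA` of run B's averaging tower of record IS run A's factor of the section of record (the tower of the
block-averaging transport; W-20 `sectionOfRecord_eq_relPair`). -/
theorem resA_towerB (b : D.carriers.BgB) : resA D (towerB D ι b) = (sectionOfRecord D ι b).1 := by
  rw [sectionOfRecord_eq_relPair]; rfl

/-- [folklore] **RUN A's (L1) IN THE FULL RUN-B COORDINATE FROM RUN A's OWN CHART LETTER.**  If a run-A species `FA`, read in run A's exponential chart at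
run A's factor of the section of record `(sectionOfRecord D ι b).1`, is ℂ-differentiable with bound `C` on the run-A coordinate ball of radius `ϱ` (the
substrate's explicit-ball letters give this at any unitary coercive centre), then `c ↦ FA ((chartAt D ι b c).1)` is ℂ-differentiable with the same bound
on the run-B coordinate ball of the same radius — the `hKA` clause of `OutputRateDrivingSlices.hslice_of_drivingSlices` at `χ := chartAt D ι`, entry by
entry (chain rule through the contraction `resA`). -/
theorem hKA_of_resA {E' : Type*} [NormedAddCommGroup E'] [NormedSpace ℂ E'] {FA : TowerData (D.F.P D.K) o → E'} {b : D.carriers.BgB} {ϱ C : ℝ}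
    (han : DifferentiableOn ℂ (fun cA => FA (expChartT _ (sectionOfRecord D ι b).1 cA)) (ball 0 ϱ))
    (hbd : ∀ cA ∈ ball (0 : TowerData (D.F.P D.K) o) ϱ, ‖FA (expChartT _ (sectionOfRecord D ι b).1 cA)‖ ≤ C) :
    DifferentiableOn ℂ (fun c => FA (chartAt D ι b c).1) (ball 0 ϱ) ∧ ∀ c ∈ ball (0 : TowerData (D.F.P (D.K + 1)) o) ϱ, ‖FA (chartAt D ι b c).1‖ ≤ C := by
  rw [← resA_towerB] at han hbd
  exact ⟨han.comp (differentiable_resA D).differentiableOn (mapsTo_resA_ball D ϱ), fun c hc => hbd _ (mapsTo_resA_ball D ϱ hc)⟩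

/-- [folklore] **RUN B's (L1) IS ITS OWN CHART LETTER VERBATIM** (`(chartAt D ι b c).2 = expChartT _ (towerB D ι b) c`, `rfl`) — stated for symmetry with
`hKA_of_resA`, so an instance feeds both clauses of `hslice_of_drivingSlices` from the two runs' explicit-ball letters by these two names. -/
theorem hKB_of_chart {E' : Type*} [NormedAddCommGroup E'] [NormedSpace ℂ E'] {FB : TowerData (D.F.P (D.K + 1)) o → E'} {b : D.carriers.BgB} {ϱ C : ℝ}
    (han : DifferentiableOn ℂ (fun c => FB (expChartT _ (towerB D ι b) c)) (ball 0 ϱ))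
    (hbd : ∀ c ∈ ball (0 : TowerData (D.F.P (D.K + 1)) o) ϱ, ‖FB (expChartT _ (towerB D ι b) c)‖ ≤ C) :
    DifferentiableOn ℂ (fun c => FB (chartAt D ι b c).2) (ball 0 ϱ) ∧ ∀ c ∈ ball (0 : TowerData (D.F.P (D.K + 1)) o) ϱ, ‖FB (chartAt D ι b c).2‖ ≤ C :=
  ⟨han, hbd⟩

/-! ## §2 The fine-field chart: slices with displayed letters, and the END -/

/-- [folklore] **THE FINE-FIELD CHART OF ROAD D** over the window `Wreg` of real admissible run-B fine fields, for reading points `u : 𝒰` read into the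
two-run chart by `emb`, species radii `ϱ k b` and depth `r` (all PARAMETERS).  Per level `k` and reading point `u`: a real CENTRE `ctr k u ∈ Wreg` and a
one-parameter SLICE COORDINATE `slice k u : ℂ → TowerData _ o` relative to `towerB (ctr k u)` — by intent the chart coordinate of the complex
covariant-averaging tower of the fine-field slice `z ↦ (ctr k u)·exp(z·H)` — with the DISPLAYED LETTERS (1) centre `slice k u 0 = 0`; (2′) COMPLEX
BLOCK-AVERAGING HOLOMORPHY `DiffContOnCl ℂ (slice k u) (ball 0 1)` ([Balaban1985Averaging] ∕ [Balaban1987RG1] (0.4)–(0.7) KIND — inhabited by nobody);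
(3) DEPTH CONTROL `MapsTo (slice k u) (closedBall 0 1) (ball 0 (ϱ k (ctr k u)))`; (4) the REAL TIE: real parameters chart AVERAGING TOWERS OF REAL FIELDS
of the window; (5) REACH: the slice passes through `emb u` at a parameter of modulus `≤ r`.  An INTERFACE: no field is constructed here (L-E18). -/
structure FineFieldChart (Wreg : Set D.carriers.BgB) (𝒰 : Type) (emb : 𝒰 → TwoRunChart D o) (ϱ : ℕ → D.carriers.BgB → ℝ) (r : ℝ) where
  /-- the real centre of the slice through `u` at level `k` -/
  ctr : ℕ → 𝒰 → D.carriers.BgB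
  /-- centres lie in the window -/
  ctr_mem : ∀ k u, ctr k u ∈ Wreg
  /-- the slice coordinate relative to `towerB (ctr k u)` -/
  slice : ℕ → 𝒰 → ℂ → TowerData (D.F.P (D.K + 1)) o
  /-- (1) the slice is centred at the real centre -/
  slice_zero : ∀ k u, slice k u 0 = 0
  /-- (2′) complex block-averaging holomorphy along the slice (LETTER) -/
  diffContOnCl : ∀ k u, DiffContOnCl ℂ (slice k u) (ball (0 : ℂ) 1)
  /-- (3) depth control: the closed unit disc charts into the species' coordinate ball (LETTER) -/
  mapsTo : ∀ k u, MapsTo (slice k u) (closedBall (0 : ℂ) 1) (ball 0 (ϱ k (ctr k u)))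
  /-- (4) the real tie: real parameters give averaging towers of real admissible fields of the window (LETTER) -/
  real : ∀ k u (x : ℝ), |x| < 1 → ∃ U ∈ Wreg, expChartT _ (towerB D ι (ctr k u)) (slice k u x) = towerB D ι U
  /-- (5) the parameter at which the slice reaches the reading point -/
  param : ℕ → 𝒰 → ℂ
  /-- (5) … of modulus at most the depth `r` -/
  norm_param_le : ∀ k u, ‖param k u‖ ≤ r
  /-- (5) … and the reach identity `χ b (a z₀) = emb u` -/
  reach : ∀ k u, chartAt D ι (ctr k u) (slice k u (param k u)) = emb u

namespace FineFieldChart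

variable {D ι} {Wreg : Set D.carriers.BgB} {𝒰 : Type} {emb : 𝒰 → TwoRunChart D o} {ϱ : ℕ → D.carriers.BgB → ℝ} {r : ℝ}
variable (𝒞 : FineFieldChart D ι Wreg 𝒰 emb ϱ r)

/-- [folklore] The real feet of every slice lie in the range of the window reading (tie (4) + §1). -/
theorem chartAt_slice_mem_range (k : ℕ) (u : 𝒰) {x : ℝ} (hx : |x| < 1) : chartAt D ι (𝒞.ctr k u) (𝒞.slice k u x) ∈ Set.range (rho D ι Wreg) := by
  obtain ⟨U, hU, h⟩ := 𝒞.real k u x hx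
  exact chartAt_mem_range_rho_of_tie D ι hU h

/-- [folklore] **RELAXING THE PARAMETERS**: larger species radii, a larger window and a larger depth keep a fine-field chart. -/
def relax {Wreg' : Set D.carriers.BgB} (hW : Wreg ⊆ Wreg') {ϱ' : ℕ → D.carriers.BgB → ℝ} (hϱ : ∀ k b, ϱ k b ≤ ϱ' k b) {r' : ℝ} (hr : r ≤ r') :
    FineFieldChart D ι Wreg' 𝒰 emb ϱ' r' where
  ctr := 𝒞.ctr
  ctr_mem k u := hW (𝒞.ctr_mem k u)
  slice := 𝒞.slice
  slice_zero := 𝒞.slice_zero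
  diffContOnCl := 𝒞.diffContOnCl
  mapsTo k u := (𝒞.mapsTo k u).mono_right (Metric.ball_subset_ball (hϱ k _))
  real k u x hx := by obtain ⟨U, hU, h⟩ := 𝒞.real k u x hx; exact ⟨U, hW hU, h⟩
  param := 𝒞.param
  norm_param_le k u := (𝒞.norm_param_le k u).trans hr
  reach := 𝒞.reach

include 𝒞 in
/-- [folklore] **THE END ON A WINDOW — the `hdrv` binder of `OutputRateDrivingSlices.hslice_of_drivingSlices` TOKEN FOR TOKEN** at `Ctr = BgR := ↥Wreg`,
`Coord := TowerData (D.F.P (D.K+1)) o`, `𝒱 := TwoRunChart D o`, `χ b := chartAt D ι b.1`, `ρ := rho D ι Wreg`, `ϱ k b := ϱ k b.1` (the window coupling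
`g ∈ W` and the entry `e` are carried and unused: the slice geometry is entry-blind). -/
theorem hdrv_on {W : Set (ℕ → ℝ)} {E : Type*} :
    ∀ k, ∀ g ∈ W, ∀ (u : 𝒰) (e : E), ∃ (b : Wreg) (a : ℂ → TowerData (D.F.P (D.K + 1)) o) (z₀ : ℂ), ‖z₀‖ ≤ r ∧ chartAt D ι b.1 (a z₀) = emb u ∧
      (∀ x : ℝ, |x| < 1 → chartAt D ι b.1 (a x) ∈ Set.range (rho D ι Wreg)) ∧ DiffContOnCl ℂ a (ball 0 1) ∧
      MapsTo a (closedBall 0 1) (ball 0 (ϱ k b.1)) :=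
  fun k _ _ u _ => ⟨⟨𝒞.ctr k u, 𝒞.ctr_mem k u⟩, 𝒞.slice k u, 𝒞.param k u, 𝒞.norm_param_le k u, 𝒞.reach k u,
    fun _ hx => 𝒞.chartAt_slice_mem_range k u hx, 𝒞.diffContOnCl k u, 𝒞.mapsTo k u⟩

/-- [folklore] **THE END ON THE WHOLE CARRIER — the `hdrv` binder of `OutputRateDrivingSlices.hslice_of_drivingSlices` TOKEN FOR TOKEN** at
`Ctr = BgR := D.carriers.BgB`, `Coord := TowerData (D.F.P (D.K+1)) o`, `𝒱 := TwoRunChart D o`, `χ := chartAt D ι`, `ρ := sectionOfRecord D ι` (R58 (1′)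
verbatim), for a fine-field chart over the trivial window `univ`. -/
theorem hdrv (𝒞₁ : FineFieldChart D ι (Set.univ : Set D.carriers.BgB) 𝒰 emb ϱ r) {W : Set (ℕ → ℝ)} {E : Type*} :
    ∀ k, ∀ g ∈ W, ∀ (u : 𝒰) (e : E), ∃ (b : D.carriers.BgB) (a : ℂ → TowerData (D.F.P (D.K + 1)) o) (z₀ : ℂ), ‖z₀‖ ≤ r ∧ chartAt D ι b (a z₀) = emb u ∧
      (∀ x : ℝ, |x| < 1 → chartAt D ι b (a x) ∈ Set.range (sectionOfRecord D ι)) ∧ DiffContOnCl ℂ a (ball 0 1) ∧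
      MapsTo a (closedBall 0 1) (ball 0 (ϱ k b)) :=
  fun k _ _ u _ => ⟨𝒞₁.ctr k u, 𝒞₁.slice k u, 𝒞₁.param k u, 𝒞₁.norm_param_le k u, 𝒞₁.reach k u,
    fun _ hx => range_rho_univ D ι ▸ 𝒞₁.chartAt_slice_mem_range k u hx, 𝒞₁.diffContOnCl k u, 𝒞₁.mapsTo k u⟩

end FineFieldChart

/-- [folklore] **TYPE NON-VACUITY ONLY** (says NOTHING about complex averaging): if every reading point IS a real foot of the window (`emb u = ρ (b u)`),
the CONSTANT slices at those feet form a fine-field chart for any positive radii and any depth `r ≥ 0`. -/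
def FineFieldChart.trivial {Wreg : Set D.carriers.BgB} {𝒰 : Type} {emb : 𝒰 → TwoRunChart D o} {ϱ : ℕ → D.carriers.BgB → ℝ} {r : ℝ}
    (b : 𝒰 → D.carriers.BgB) (hb : ∀ u, b u ∈ Wreg) (hemb : ∀ u, emb u = sectionOfRecord D ι (b u)) (hϱ : ∀ k u, 0 < ϱ k (b u)) (hr : 0 ≤ r) :
    FineFieldChart D ι Wreg 𝒰 emb ϱ r where
  ctr _ u := b u
  ctr_mem _ u := hb u
  slice _ _ _ := 0
  slice_zero _ _ := rfl
  diffContOnCl _ _ := diffContOnCl_const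
  mapsTo k u _ _ := Metric.mem_ball_self (hϱ k u)
  real _ u _ _ := ⟨b u, hb u, expChartT_zero _ _⟩
  param _ _ := 0
  norm_param_le _ _ := by rw [norm_zero]; exact hr
  reach _ u := by rw [chartAt_zero]; exact (hemb u).symm

/-- [folklore] The trivial chart's slices are the constant `0` (`rfl`). -/
theorem FineFieldChart.trivial_slice {Wreg : Set D.carriers.BgB} {𝒰 : Type} {emb : 𝒰 → TwoRunChart D o} {ϱ : ℕ → D.carriers.BgB → ℝ} {r : ℝ}
    (b : 𝒰 → D.carriers.BgB) (hb : ∀ u, b u ∈ Wreg) (hemb : ∀ u, emb u = sectionOfRecord D ι (b u)) (hϱ : ∀ k u, 0 < ϱ k (b u)) (hr : 0 ≤ r)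
    (k : ℕ) (u : 𝒰) (z : ℂ) : (FineFieldChart.trivial D ι b hb hemb hϱ hr).slice k u z = 0 := rfl

/-! ## §3 (L1) meets (L2′) on the same chart: the slice as a complex background family of record -/

namespace FineFieldChart

variable {D ι} {Wreg : Set D.carriers.BgB} {𝒰 : Type} {emb : 𝒰 → TwoRunChart D o} {ϱ : ℕ → D.carriers.BgB → ℝ} {r : ℝ}
variable (𝒞 : FineFieldChart D ι Wreg 𝒰 emb ϱ r)

/-- [folklore] Per-entry holomorphy of the slice coordinate on the open unit disc (from letter (2′)). -/
theorem differentiableOn_slice_apply (k : ℕ) (u : 𝒰) (j : Fin ((D.F.P (D.K + 1)).K + 1)) (ν : Fin (D.F.P (D.K + 1)).d)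
    (x : Tor (fine (lev (D.F.P (D.K + 1)).L j) (unitMod (D.F.P (D.K + 1)))) × Fin (D.F.P (D.K + 1)).d) :
    DifferentiableOn ℂ (fun z => 𝒞.slice k u z j ν x) (ball (0 : ℂ) 1) :=
  differentiableOn_pi.1 (differentiableOn_pi.1 (differentiableOn_pi.1 (𝒞.diffContOnCl k u).differentiableOn j) ν) x

/-- [folklore] **THE SLICE IS A CHART-COORDINATE COMPLEX BACKGROUND FAMILY OF RECORD** (p222080 `ComplexBackgroundFamily.ofChart`, parameter space `ℂ`,
radius `1`, centre `towerB (ctr k u)`): `uC z = expChartT _ (towerB (ctr k u)) (slice k u z)` — so every family-layer lemma applies BY NAME. -/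
def family (k : ℕ) (u : 𝒰) : ComplexBackgroundFamily (D.F.P (D.K + 1)) ℂ (towerB D ι (𝒞.ctr k u)) 1 :=
  ComplexBackgroundFamily.ofChart (towerB D ι (𝒞.ctr k u)) 1 (𝒞.slice k u) (𝒞.slice_zero k u) (𝒞.differentiableOn_slice_apply k u)

/-- [folklore] `rfl` views of the family's two sides. -/
theorem family_uC (k : ℕ) (u : 𝒰) (z : ℂ) :
    (𝒞.family k u).uC z = expChartT _ (towerB D ι (𝒞.ctr k u)) (𝒞.slice k u z) ∧
      (𝒞.family k u).uCinv z = expChartInvT _ (towerB D ι (𝒞.ctr k u)) (𝒞.slice k u z) := ⟨rfl, rfl⟩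

/-- [folklore] The family's `R`-side IS run B's factor of the chart point along the slice (`rfl`). -/
theorem family_uC_eq_chartAt_snd (k : ℕ) (u : 𝒰) (z : ℂ) : (𝒞.family k u).uC z = (chartAt D ι (𝒞.ctr k u) (𝒞.slice k u z)).2 := rfl

section Species

variable (cL : ℕ → ℂ) (aL : ℕ → ℝ) (s : ℕ → ℂ)
  (Γ : (j : ℕ) → ContourSystem (D.F.P (D.K + 1)).d (lev (D.F.P (D.K + 1)).L j) (unitMod (D.F.P (D.K + 1))))

/-- [folklore] **RUN B's LEVEL-LETTERED COVARIANCE SPECIES ALONG A FINE-FIELD SLICE IS ℂ-DIFFERENTIABLE on the regular part of the disc** — p223543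
`differentiableOn_covAtTLev_family` BY NAME: letter (2′) composed with the species' holomorphy in the background (the family layer's (L1)). -/
theorem differentiableOn_covB_slice (k : ℕ) (u : 𝒰) (j : ℕ) {T : Type*} (t : T)
    (b b' : (Tor (unitMod (D.F.P (D.K + 1))) × Fin (D.F.P (D.K + 1)).d) × o) :
    DifferentiableOn ℂ (fun z => covAtTLev (D.F.P (D.K + 1)) cL aL Γ s ((𝒞.family k u).uC z) ((𝒞.family k u).uCinv z) j t b b')
      (ball (0 : ℂ) 1 ∩ regularLev (D.F.P (D.K + 1)) cL aL Γ (𝒞.family k u)) :=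
  differentiableOn_covAtTLev_family (D.F.P (D.K + 1)) cL aL Γ (𝒞.family k u) s j t b b'

/-- [folklore] **RUN A's SPECIES ALONG THE SLICE = RUN B's TORUS LETTERS AT THE RELATED DATA for aligned levels `j ≤ K`** (W-20 `covAtTLev_resA`), hence
ℂ-differentiable on the same set — ONE slice coordinate serves both runs (R58 (1′): run A through `resA`). -/
theorem differentiableOn_covA_slice (k : ℕ) (u : 𝒰) {j : ℕ} (hj : j ≤ D.K) {T : Type*} (t : T)
    (b b' : (Tor (unitMod (D.F.P (D.K + 1))) × Fin (D.F.P (D.K + 1)).d) × o) :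
    DifferentiableOn ℂ (fun z => covAtTLev (D.F.P D.K) cL aL Γ s (resA D ((𝒞.family k u).uC z)) (resA D ((𝒞.family k u).uCinv z)) j t b b')
      (ball (0 : ℂ) 1 ∩ regularLev (D.F.P (D.K + 1)) cL aL Γ (𝒞.family k u)) :=
  (𝒞.differentiableOn_covB_slice cL aL s Γ k u j t b b').congr fun _ _ => covAtTLev_resA D cL aL s Γ _ _ hj t b b'

/-- [folklore] **DEPTH CONTROL BUYS REGULARITY ON THE CLOSED DISC — NO OPENNESS ARGUMENT**: at the printed letters, if the centre tower is unitary and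
levelwise `γ_j`-coercive (the letters L-E12's `rhoStar` takes) and the species radius at the centre does not exceed `ρ⋆`, then by letter (3) EVERY
parameter of the closed unit disc is regular at every level (p223543 `mem_regularLev_ofChart_of_norm_lt_rhoStar` BY NAME). -/
theorem mem_regularLev_slice_of_le (k : ℕ) (u : 𝒰)
    (hR₀ : ∀ (j : Fin ((D.F.P (D.K + 1)).K + 1)) ν i, towerB D ι (𝒞.ctr k u) j ν i ∈ Matrix.unitaryGroup o ℂ) {a' : ℝ}
    {γ : Fin ((D.F.P (D.K + 1)).K + 1) → ℝ}
    (hco : ∀ j : Fin ((D.F.P (D.K + 1)).K + 1), Coercive (γ j) (vecOp (lev (D.F.P (D.K + 1)).L j) (unitMod (D.F.P (D.K + 1))) a' (Γ j)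
      (towerB D ι (𝒞.ctr k u) j)))
    (hγ : ∀ j, 0 < γ j) (hϱ : ϱ k (𝒞.ctr k u) ≤ rhoStar (D.F.P (D.K + 1)) Γ hR₀ hco hγ) {z : ℂ} (hz : ‖z‖ ≤ 1) :
    z ∈ regularLev (D.F.P (D.K + 1)) (cPr (D.F.P (D.K + 1))) (aPr (D.F.P (D.K + 1)) a') Γ (𝒞.family k u) :=
  mem_regularLev_ofChart_of_norm_lt_rhoStar (D.F.P (D.K + 1)) Γ (towerB D ι (𝒞.ctr k u)) 1 (𝒞.slice k u) (𝒞.slice_zero k u)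
    (𝒞.differentiableOn_slice_apply k u) hR₀ hco hγ
    (lt_of_lt_of_le (mem_ball_zero_iff.1 (𝒞.mapsTo k u (mem_closedBall_zero_iff.2 hz))) hϱ)

end Species

end FineFieldChart

end Summit.QuantumFields.BalabanUV.T4Continuum.SubstrateFineFieldChart

end
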